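import Literature.NumberTheory.GaloisRepresentations.GaloisRepUnramifiedProofs
import Literature.NumberTheory.GaloisRepresentations.LocalGaloisGroupProofs
import HarnessLib

/-!
# The decomposition group, inertia group and Frobenius at the prime of a completion

Topic `NumberTheory/GaloisRepresentations`; a sibling of `GaloisRepUnramifiedProofs` (theorems and
one definition, no named fact).  Let `K` be a number field, `v` a finite place, `K_v` its completion
(`v.adicCompletion K`, a non-archimedean local field on its own topology:
`[ValuativeRel K_v] [IsNonarchimedeanLocalField K_v]` as in `GaloisRep.lean`), `ι : K̄ → \bar K_v`
the chosen embedding (`absClosureEmbedding`), `res : Γ_{K_v} → Γ_K` the restriction along `ι`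
(`absGaloisRestrict`), and `𝔓₀ = {s ∈ \bar ℤ_K : |ι s|_v < 1}` the prime of `\bar ℤ_K` above `v` cut
out by `ι` (`GaloisRepUnramifiedProofs`, proof of `isUnramifiedAt_iff_toLocal_holds`).
`GaloisRepUnramifiedProofs` proves Neukirch's Prop. II.9.6 in the form needed for unramifiedness
(`res (I_{K_v})` lands in `I_{𝔓₀}`, every `τ ∈ D_{𝔓₀}` lifts to `Γ_{K_v}`, a lift of an inertial
`τ` is inertial).  This file records the remaining half of the dictionary between the *local*
absolute Galois group and the *global* decomposition group, which every "`ρ|_{G_p}`" statement of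
the modularity literature uses (e.g. Breuil–Conrad–Diamond–Taylor 2001, proof of Thm. 2.2.1:
"`ρ̄|_{G₃}` is given by the character …", with `G₃ = Gal(\bar ℚ₃/ℚ₃)` identified with a decomposition
group at `3` in `G_ℚ`):

* `adicCompletionPrime K v = 𝔓₀`, a DEFINITION (by choice from
  `exists_ideal_forall_mem_iff_spectralNorm_lt_one`) with `mem_adicCompletionPrime_iff`,
  `adicCompletionPrime_mem_primesAbove`;
* `absGaloisRestrict_smul_eq_of_forall_mem_iff` — `res σ • 𝔓₀ = 𝔓₀` (`Γ_{K_v}` acts on `\bar K_v`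
  by isometries), whence **`D_{𝔓₀} = res (Γ_{K_v})`**
  (`decompositionSubgroup_eq_range_absGaloisRestrict`, Neukirch II (9.6): `G_w(L|K) ≅ G(L_w|K_v)`)
  and **`I_{𝔓₀} = res (I_{K_v})`** (`inertia_eq_map_absInertia_absGaloisRestrict`);
* **Frobenius**: `res σ` is an arithmetic Frobenius at `𝔓₀` (Mathlib `IsArithFrobAt (𝓞 K) · 𝔓₀`)
  iff `σ` is an arithmetic Frobenius of the local field (`IsAbsArithFrob`, `LocalGaloisGroup.lean`):
  `isArithFrobAt_absGaloisRestrict_of_isAbsArithFrob` (for `s ∈ \bar ℤ_K`,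
  `ι (res σ • s - s^q) = σ • ι s - (ι s)^q`) and `isAbsArithFrob_of_isArithFrobAt_absGaloisRestrict`
  (density of `ι(K̄)` in `\bar K_v` and the estimate `|a^q - b^q| ≤ |a - b|` on the unit ball), both
  under the hypothesis `hq` that the two residue fields have the same cardinality (discharged for
  Mathlib's valued structure of `K_v` in `Automorphic/AdicCompletionResidueCard`);
* packaged at `K_v`: `decompositionSubgroup_adicCompletionPrime_eq_range`,
  `inertia_adicCompletionPrime_eq_map_absInertia`, `map_decompositionSubgroup_adicCompletionPrime`,
  `map_inertia_adicCompletionPrime` (images under a homomorphism `f` of `Γ_K`: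
  `f(D_{𝔓₀}) = (f ∘ res)(Γ_{K_v})`, `f(I_{𝔓₀}) = (f ∘ res)(I_{K_v})`),
  `isArithFrobAt_absGaloisRestrict_adicCompletionPrime_iff`.

## References

* J. Neukirch, *Algebraic Number Theory*, Grundlehren 322 (1999), Ch. II §9, Prop. (9.6) and (9.4);
  Ch. I §9 (decomposition group, Frobenius). [NeukirchANT1999]
* J.-P. Serre, *Local Fields*, GTM 67 (1979), Ch. II §3, Cor. 4; Ch. I §8. [SerreLocalFields1979]
* C. Breuil, B. Conrad, F. Diamond, R. Taylor, J. Amer. Math. Soc. 14 (2001), §2.2 (the consumer).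
  [BCDTJAMS2001]
-/

noncomputable section

open scoped NumberField Pointwise Valued
open Field IsDedekindDomain ValuativeRel

universe u

namespace Literature.NumberTheory.GaloisRepresentations

open IsNonarchimedeanLocalField

/-! ### A complete field `L ⊇ K` in place of `K_v` -/

section LocalField

variable {K : Type u} [Field K] {L : Type*} [NontriviallyNormedField L] [Algebra K L]

/-- **`res σ • 𝔓₀ = 𝔓₀`**: the restriction of any `σ ∈ Γ_L` fixes the prime
`𝔓₀ = {s : |ι s| < 1}` cut out by `ι : K̄ → L̄`, because `Γ_L` acts on `L̄` by isometries of the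
spectral norm (`spectralNorm_absoluteGaloisGroup_smul`) and `ι (res σ • s) = σ • ι s`.
Neukirch, *Algebraic Number Theory*, Ch. II §9, (9.4) and proof of (9.6) ("`G(L_w|K_v) → G_w`").
[cite: NeukirchANT1999, Ch. II §9 Prop. (9.6)] -/
theorem absGaloisRestrict_smul_eq_of_forall_mem_iff (𝔓 : Ideal (absIntegers (𝓞 K) K))
    (h𝔓 : ∀ s : absIntegers (𝓞 K) K,
      s ∈ 𝔓 ↔ spectralNorm L (AlgebraicClosure L) (absClosureEmbedding K L s) < 1)
    (σ : absoluteGaloisGroup L) : absGaloisRestrict K L σ • 𝔓 = 𝔓 := by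
  ext s
  rw [Ideal.mem_pointwise_smul_iff_inv_smul_mem, h𝔓, h𝔓, integralClosure.coe_smul, ← map_inv,
    absGaloisRestrict_apply_smul, spectralNorm_absoluteGaloisGroup_smul]

/-- `res (Γ_L) ⊆ D_{𝔓₀}`: restrictions of elements of `Γ_L` lie in the decomposition group of
`𝔓₀`. Neukirch, *Algebraic Number Theory*, Ch. II §9, (9.4). [cite: NeukirchANT1999, Ch. II §9 Prop. (9.6)] -/
theorem absGaloisRestrict_mem_decompositionSubgroup_of_forall_mem_iff
    (𝔓 : Ideal (absIntegers (𝓞 K) K))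
    (h𝔓 : ∀ s : absIntegers (𝓞 K) K,
      s ∈ 𝔓 ↔ spectralNorm L (AlgebraicClosure L) (absClosureEmbedding K L s) < 1)
    (σ : absoluteGaloisGroup L) :
    absGaloisRestrict K L σ ∈ 𝔓.decompositionSubgroup (absoluteGaloisGroup K) :=
  Ideal.mem_decompositionSubgroup_iff.mpr (absGaloisRestrict_smul_eq_of_forall_mem_iff 𝔓 h𝔓 σ)

variable [CompleteSpace L] [IsUltrametricDist L]

/-- **`D_{𝔓₀} = res (Γ_L)`** (Neukirch, *Algebraic Number Theory*, Ch. II §9, Prop. (9.6):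
`G_w(L|K) ≅ G(L_w|K_v)`, for the infinite extension `K̄/K` and `L` in place of `K_v`): if `K` is
dense in `L` and `‖·‖ ≤ 1` on `𝓞 K` with a value in `(0, 1)` on `K`, the decomposition group of
`𝔓₀ = {s : |ι s| < 1}` is the image of the restriction map `res : Γ_L → Γ_K`.  `⊇` is the previous
theorem; `⊆`: every `τ` with `τ • 𝔓₀ = 𝔓₀` is an isometry of the dense subfield `ι(K̄)` of `L̄` and
extends to `L̄` (`exists_forall_smul_absClosureEmbedding_eq`), the extension restricting to `τ`
(`absGaloisRestrict_eq_of_forall_smul`). [cite: NeukirchANT1999, Ch. II §9 Prop. (9.6)] -/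
theorem decompositionSubgroup_eq_range_absGaloisRestrict [NumberField K]
    (hd : DenseRange (algebraMap K L)) (hO : ∀ r : 𝓞 K, ‖algebraMap (𝓞 K) L r‖ ≤ 1)
    (hK : ∃ k : K, 0 < ‖algebraMap K L k‖ ∧ ‖algebraMap K L k‖ < 1)
    (𝔓 : Ideal (absIntegers (𝓞 K) K))
    (h𝔓 : ∀ s : absIntegers (𝓞 K) K,
      s ∈ 𝔓 ↔ spectralNorm L (AlgebraicClosure L) (absClosureEmbedding K L s) < 1) :
    𝔓.decompositionSubgroup (absoluteGaloisGroup K) = (absGaloisRestrict K L).toMonoidHom.range := by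
  refine le_antisymm (fun τ hτ ↦ ?_) ?_
  · obtain ⟨σ, hσ⟩ := exists_forall_smul_absClosureEmbedding_eq hd hO hK 𝔓 h𝔓
      (Ideal.mem_decompositionSubgroup_iff.mp hτ)
    exact ⟨σ, absGaloisRestrict_eq_of_forall_smul hσ⟩
  · rintro _ ⟨σ, rfl⟩
    exact absGaloisRestrict_mem_decompositionSubgroup_of_forall_mem_iff 𝔓 h𝔓 σ

/-- **`I_{𝔓₀} = res (I_L)`** (Neukirch, *Algebraic Number Theory*, Ch. II §9, Prop. (9.6):
`I_w(L|K) ≅ I(L_w|K_v)`): under the hypotheses of `decompositionSubgroup_eq_range_absGaloisRestrict`,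
with a `[ValuativeRel L]` local-field structure compatible with `‖·‖` and `𝔓₀` maximal, the inertia
group of `𝔓₀` is the image under `res` of the local inertia group `I_L = absInertia L`
(`exists_absGaloisRestrict_eq_of_mem_inertia` and `absGaloisRestrict_mem_inertia_of_mem_absInertia`
of `GaloisRepUnramifiedProofs`). [cite: NeukirchANT1999, Ch. II §9 Prop. (9.6)] -/
theorem inertia_eq_map_absInertia_absGaloisRestrict [NumberField K] [ValuativeRel L]
    [IsNonarchimedeanLocalField L] (hw : ∀ x : L, valuation L x ≤ 1 ↔ ‖x‖ ≤ 1)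
    (hd : DenseRange (algebraMap K L)) (hO : ∀ r : 𝓞 K, ‖algebraMap (𝓞 K) L r‖ ≤ 1)
    (hK : ∃ k : K, 0 < ‖algebraMap K L k‖ ∧ ‖algebraMap K L k‖ < 1)
    (𝔓 : Ideal (absIntegers (𝓞 K) K))
    (h𝔓 : ∀ s : absIntegers (𝓞 K) K,
      s ∈ 𝔓 ↔ spectralNorm L (AlgebraicClosure L) (absClosureEmbedding K L s) < 1)
    (hmax : 𝔓.IsMaximal) :
    𝔓.inertia (absoluteGaloisGroup K) = (absInertia L).map (absGaloisRestrict K L).toMonoidHom := by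
  refine le_antisymm (fun τ hτ ↦ ?_) ?_
  · obtain ⟨σ, hσ, rfl⟩ := exists_absGaloisRestrict_eq_of_mem_inertia hw hd hO hK 𝔓 h𝔓 hmax hτ
    exact ⟨σ, hσ, rfl⟩
  · rintro _ ⟨σ, hσ, rfl⟩
    exact absGaloisRestrict_mem_inertia_of_mem_absInertia hw hO 𝔓 h𝔓 hσ

/-- **Local Frobenius ⇒ global Frobenius.**  Let `[ValuativeRel L]` be a local-field structure on
`L` compatible with `‖·‖`, `‖·‖ ≤ 1` on `𝓞 K`, and suppose the residue fields of `L` and of `𝔓₀`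
have the same cardinality `q` (`hq`).  If `σ ∈ Γ_L` is an arithmetic Frobenius of `L`
(`IsAbsArithFrob σ`: `σ • y ≡ y^q` modulo the prime of `L̄`, for all integers `y` of `L̄`), then
`res σ` is an arithmetic Frobenius at `𝔓₀` (`IsArithFrobAt (𝓞 K) (res σ) 𝔓₀`): for `s ∈ \bar ℤ_K`,
`ι (res σ • s - s^q) = σ • ι s - (ι s)^q` lies in the prime of `L̄`, the open unit ball.
Neukirch, *Algebraic Number Theory*, Ch. I §9 and Ch. II §9 (compatibility of Frobenius with
completion). [cite: NeukirchANT1999, Ch. II §9 Prop. (9.6)] -/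
theorem isArithFrobAt_absGaloisRestrict_of_isAbsArithFrob [ValuativeRel L]
    [IsNonarchimedeanLocalField L] (hw : ∀ x : L, valuation L x ≤ 1 ↔ ‖x‖ ≤ 1)
    (hO : ∀ r : 𝓞 K, ‖algebraMap (𝓞 K) L r‖ ≤ 1) (𝔓 : Ideal (absIntegers (𝓞 K) K))
    (h𝔓 : ∀ s : absIntegers (𝓞 K) K,
      s ∈ 𝔓 ↔ spectralNorm L (AlgebraicClosure L) (absClosureEmbedding K L s) < 1)
    (hq : residueFieldCard L = Nat.card (𝓞 K ⧸ 𝔓.under (𝓞 K)))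
    {σ : absoluteGaloisGroup L} (hσ : IsAbsArithFrob σ) :
    IsArithFrobAt (𝓞 K) (absGaloisRestrict K L σ) 𝔓 := by
  rw [isAbsArithFrob_iff_holds] at hσ
  have hmem : ∀ s : absIntegers (𝓞 K) K,
      absClosureEmbedding K L s ∈ absIntegers (valuation L).integer L :=
    absClosureEmbedding_mem_absIntegers_integer K L (valuation L) (fun r => (hw _).mpr (hO r))
  intro s
  change absGaloisRestrict K L σ • s - s ^ Nat.card (𝓞 K ⧸ 𝔓.under (𝓞 K)) ∈ 𝔓
  rw [← hq, h𝔓]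
  have hy := (mem_radical_map_maximalIdeal_iff hw _).mp
    (hσ ⟨absClosureEmbedding K L s, hmem s⟩)
  have h_eq : absClosureEmbedding K L
        ((absGaloisRestrict K L σ • s - s ^ residueFieldCard L : absIntegers (𝓞 K) K) :
          AlgebraicClosure K) =
      ((σ • (⟨absClosureEmbedding K L s, hmem s⟩ : absIntegers (valuation L).integer L) -
        ⟨absClosureEmbedding K L s, hmem s⟩ ^ residueFieldCard L :
          absIntegers (valuation L).integer L) : AlgebraicClosure L) := by
    rw [Subalgebra.coe_sub, Subalgebra.coe_pow, map_sub, map_pow, integralClosure.coe_smul,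
      absGaloisRestrict_apply_smul, Subalgebra.coe_sub, Subalgebra.coe_pow,
      integralClosure.coe_smul]
  rw [h_eq]
  exact hy

/-- In an ultrametric normed field, `‖a ^ n - b ^ n‖ ≤ ‖a - b‖` for `‖a‖, ‖b‖ ≤ 1`
(`a^{n+1} - b^{n+1} = a (a^n - b^n) + (a - b) b^n`). [folklore] -/
theorem norm_pow_sub_pow_le_of_norm_le_one {F : Type*} [NormedField F] [IsUltrametricDist F]
    {a b : F} (ha : ‖a‖ ≤ 1) (hb : ‖b‖ ≤ 1) (n : ℕ) : ‖a ^ n - b ^ n‖ ≤ ‖a - b‖ := by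
  induction n with
  | zero => simp
  | succ n ih =>
    have e : a ^ (n + 1) - b ^ (n + 1) = a * (a ^ n - b ^ n) + (a - b) * b ^ n := by ring
    rw [e]
    refine (IsUltrametricDist.norm_add_le_max _ _).trans (max_le ?_ ?_)
    · rw [norm_mul]
      exact (mul_le_of_le_one_left (norm_nonneg _) ha).trans ih
    · rw [norm_mul, norm_pow]
      exact mul_le_of_le_one_right (norm_nonneg _) (pow_le_one₀ (norm_nonneg _) hb)

/-- **Global Frobenius ⇒ local Frobenius.**  Conversely to
`isArithFrobAt_absGaloisRestrict_of_isAbsArithFrob`, with moreover `K` dense in `L` and `𝔓₀`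
maximal: if `res σ` is an arithmetic Frobenius at `𝔓₀`, then `σ` is an arithmetic Frobenius of
`L`.  For an integer `y` of `L̄` choose `s ∈ \bar ℤ_K` with `|y - ι s| < 1` (`ι(K̄)` is dense in `L̄`,
`exists_spectralNorm_sub_absClosureEmbedding_lt`, then `exists_absoluteValue_sub_lt_one`); then
`σ • y - y^q = σ • (y - ι s) + ι (res σ • s - s^q) + ((ι s)^q - y^q)` has norm `< 1`, `σ` being an
isometry and `|a^q - b^q| ≤ |a - b|` on the unit ball.  Neukirch, *Algebraic Number Theory*,
Ch. II §9, proof of Prop. (9.6). [cite: NeukirchANT1999, Ch. II §9 Prop. (9.6)] -/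
theorem isAbsArithFrob_of_isArithFrobAt_absGaloisRestrict [NumberField K] [ValuativeRel L]
    [IsNonarchimedeanLocalField L] (hw : ∀ x : L, valuation L x ≤ 1 ↔ ‖x‖ ≤ 1)
    (hd : DenseRange (algebraMap K L)) (𝔓 : Ideal (absIntegers (𝓞 K) K))
    (h𝔓 : ∀ s : absIntegers (𝓞 K) K,
      s ∈ 𝔓 ↔ spectralNorm L (AlgebraicClosure L) (absClosureEmbedding K L s) < 1)
    (hmax : 𝔓.IsMaximal) (hq : residueFieldCard L = Nat.card (𝓞 K ⧸ 𝔓.under (𝓞 K)))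
    {σ : absoluteGaloisGroup L} (hσ : IsArithFrobAt (𝓞 K) (absGaloisRestrict K L σ) 𝔓) :
    IsAbsArithFrob σ := by
  letI : NormedField (AlgebraicClosure L) := spectralNorm.normedField L (AlgebraicClosure L)
  haveI : IsUltrametricDist (AlgebraicClosure L) :=
    IsUltrametricDist.isUltrametricDist_of_forall_norm_add_le_max_norm isNonarchimedean_spectralNorm
  -- the absolute value `|ι ·|` of `K̄`
  let f : AbsoluteValue (AlgebraicClosure K) ℝ :=
    (NormedField.toAbsoluteValue (AlgebraicClosure L)).comp (absClosureEmbedding K L).injective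
  have hf' : ∀ x, f x = ‖absClosureEmbedding K L x‖ := fun _ => rfl
  have hf : IsNonarchimedean f := fun a b => by
    rw [hf', hf', hf', map_add]
    exact IsUltrametricDist.norm_add_le_max _ _
  have h𝔓' : ∀ s : absIntegers (𝓞 K) K, s ∈ 𝔓 ↔ f s < 1 := fun s => by rw [hf']; exact h𝔓 s
  set q := residueFieldCard L with hqdef
  -- the global Frobenius congruence, read in `L̄`
  have hσ' : ∀ s : absIntegers (𝓞 K) K,
      ‖σ • absClosureEmbedding K L s - absClosureEmbedding K L s ^ q‖ < 1 := by
    intro s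
    have h := (h𝔓 _).mp (hσ s)
    change spectralNorm L (AlgebraicClosure L) (absClosureEmbedding K L
      ((absGaloisRestrict K L σ • s - s ^ Nat.card (𝓞 K ⧸ 𝔓.under (𝓞 K)) :
        absIntegers (𝓞 K) K) : AlgebraicClosure K)) < 1 at h
    rw [← hq, Subalgebra.coe_sub, Subalgebra.coe_pow, map_sub, map_pow, integralClosure.coe_smul,
      absGaloisRestrict_apply_smul] at h
    exact h
  rw [isAbsArithFrob_iff_holds]
  intro y
  refine (mem_radical_map_maximalIdeal_iff hw _).mpr ?_
  change ‖((σ • y - y ^ q : absIntegers (valuation L).integer L) : AlgebraicClosure L)‖ < 1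
  rw [Subalgebra.coe_sub, Subalgebra.coe_pow, integralClosure.coe_smul]
  have hy : ‖(y : AlgebraicClosure L)‖ ≤ 1 :=
    (mem_absIntegers_integer_iff_spectralNorm_le_one hw (y : AlgebraicClosure L)).mp y.2
  -- `s ∈ \bar ℤ_K` with `‖y - ι s‖ < 1`
  obtain ⟨x, hx⟩ := exists_spectralNorm_sub_absClosureEmbedding_lt hd (y : AlgebraicClosure L)
    one_pos
  change ‖(y : AlgebraicClosure L) - absClosureEmbedding K L x‖ < 1 at hx
  have hx1 : f x ≤ 1 := by
    have e : absClosureEmbedding K L x = y + -(y - absClosureEmbedding K L x) := by abel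
    rw [hf', e]
    exact (IsUltrametricDist.norm_add_le_max _ _).trans
      (max_le hy (by rw [norm_neg]; exact hx.le))
  obtain ⟨s, hs⟩ := exists_absoluteValue_sub_lt_one hf h𝔓' hmax hx1
  rw [hf', map_sub] at hs
  have hys : ‖(y : AlgebraicClosure L) - absClosureEmbedding K L s‖ < 1 := by
    rw [← sub_add_sub_cancel _ (absClosureEmbedding K L x) _]
    exact (IsUltrametricDist.norm_add_le_max _ _).trans_lt (max_lt hx hs)
  have hs1 : ‖absClosureEmbedding K L (s : AlgebraicClosure K)‖ ≤ 1 := by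
    have e : absClosureEmbedding K L (s : AlgebraicClosure K) =
        y + -(y - absClosureEmbedding K L s) := by abel
    rw [e]
    exact (IsUltrametricDist.norm_add_le_max _ _).trans
      (max_le hy (by rw [norm_neg]; exact hys.le))
  -- the three-term estimate
  have h1 : ‖σ • ((y : AlgebraicClosure L) - absClosureEmbedding K L s)‖ < 1 := by
    change spectralNorm L (AlgebraicClosure L)
      (σ • ((y : AlgebraicClosure L) - absClosureEmbedding K L s)) < 1
    rw [spectralNorm_absoluteGaloisGroup_smul]
    exact hys
  have h2 := hσ' s
  have h3 : ‖absClosureEmbedding K L (s : AlgebraicClosure K) ^ q - (y : AlgebraicClosure L) ^ q‖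
      < 1 :=
    (norm_pow_sub_pow_le_of_norm_le_one hs1 hy q).trans_lt (by rw [norm_sub_rev]; exact hys)
  calc ‖σ • (y : AlgebraicClosure L) - (y : AlgebraicClosure L) ^ q‖
        = ‖σ • ((y : AlgebraicClosure L) - absClosureEmbedding K L s) +
            (σ • absClosureEmbedding K L (s : AlgebraicClosure K) -
              absClosureEmbedding K L (s : AlgebraicClosure K) ^ q) +
            (absClosureEmbedding K L (s : AlgebraicClosure K) ^ q - (y : AlgebraicClosure L) ^ q)‖ := by
          rw [smul_sub]
          abel_nf
    _ ≤ max (max ‖σ • ((y : AlgebraicClosure L) - absClosureEmbedding K L s)‖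
          ‖σ • absClosureEmbedding K L (s : AlgebraicClosure K) -
              absClosureEmbedding K L (s : AlgebraicClosure K) ^ q‖)
          ‖absClosureEmbedding K L (s : AlgebraicClosure K) ^ q - (y : AlgebraicClosure L) ^ q‖ :=
          (IsUltrametricDist.norm_add_le_max _ _).trans
            (max_le_max (IsUltrametricDist.norm_add_le_max _ _) le_rfl)
    _ < 1 := max_lt (max_lt h1 h2) h3

end LocalField

/-! ### The completion `K_v` -/

section AdicCompletion

variable (K : Type u) [Field K] [NumberField K] (v : HeightOneSpectrum (𝓞 K))

/-- **The prime `𝔓₀` of `\bar ℤ_K` above `v` cut out by the chosen embedding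
`ι : K̄ → \bar K_v`**: `𝔓₀ = {s ∈ \bar ℤ_K : |ι s|_v < 1}` (the open unit ball of the absolute value
`|ι ·|_v`, `|·|_v` the spectral norm of `\bar K_v / K_v`), chosen from
`exists_ideal_forall_mem_iff_spectralNorm_lt_one`; its decomposition group is the image of
`Γ_{K_v}` and its inertia group the image of `I_{K_v}` (below).  Neukirch, *Algebraic Number Theory*,
Ch. II (8.1)–(8.2) (primes above `𝔭` ↔ embeddings into `\bar K_𝔭`). [folklore] -/
def adicCompletionPrime : Ideal (absIntegers (𝓞 K) K) :=
  (exists_ideal_forall_mem_iff_spectralNorm_lt_one K (v.adicCompletion K)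
    (norm_algebraMap_ringOfIntegers_le_one K v)).choose

/-- Membership in `𝔓₀ = adicCompletionPrime K v`: `s ∈ 𝔓₀ ↔ |ι s|_v < 1`. [folklore] -/
theorem mem_adicCompletionPrime_iff (s : absIntegers (𝓞 K) K) :
    s ∈ adicCompletionPrime K v ↔
      spectralNorm (v.adicCompletion K) (AlgebraicClosure (v.adicCompletion K))
        (absClosureEmbedding K (v.adicCompletion K) s) < 1 :=
  (exists_ideal_forall_mem_iff_spectralNorm_lt_one K (v.adicCompletion K)
    (norm_algebraMap_ringOfIntegers_le_one K v)).choose_spec s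

/-- `𝔓₀` is a prime of `\bar ℤ_K` above `v`. [folklore] -/
theorem adicCompletionPrime_mem_primesAbove : adicCompletionPrime K v ∈ v.primesAbove :=
  mem_primesAbove_of_forall_mem_iff v (norm_algebraMap_ringOfIntegers_lt_one_iff K v) _
    (mem_adicCompletionPrime_iff K v)

/-- `𝔓₀` is a maximal ideal of `\bar ℤ_K`. [folklore] -/
theorem adicCompletionPrime_isMaximal : (adicCompletionPrime K v).IsMaximal :=
  HeightOneSpectrum.isMaximal_of_mem_primesAbove (adicCompletionPrime_mem_primesAbove K v)

/-- `𝔓₀` is a prime ideal. [folklore] -/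
instance adicCompletionPrime_isPrime : (adicCompletionPrime K v).IsPrime :=
  (adicCompletionPrime_isMaximal K v).isPrime

/-- `𝔓₀ ∩ 𝓞 K = v`. [folklore] -/
theorem under_adicCompletionPrime : (adicCompletionPrime K v).under (𝓞 K) = v.asIdeal :=
  ((adicCompletionPrime_mem_primesAbove K v).2.over).symm

/-- **`D_{𝔓₀} = res (Γ_{K_v})`**: the decomposition group in `Γ_K` of the prime `𝔓₀` above `v` cut
out by the chosen embedding `K̄ → \bar K_v` is the image of the restriction map
`res : Γ_{K_v} → Γ_K`.  Neukirch, *Algebraic Number Theory*, Ch. II §9, Prop. (9.6)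
(`G_w(L|K) ≅ G(L_w|K_v)`); Serre, *Local Fields*, Ch. II §3, Cor. 4.
[cite: NeukirchANT1999, Ch. II §9 Prop. (9.6)] -/
theorem decompositionSubgroup_adicCompletionPrime_eq_range :
    (adicCompletionPrime K v).decompositionSubgroup (absoluteGaloisGroup K) =
      (absGaloisRestrict K (v.adicCompletion K)).toMonoidHom.range :=
  decompositionSubgroup_eq_range_absGaloisRestrict
    (IsDedekindDomain.HeightOneSpectrum.denseRange_algebraMap (K := K) (v := v))
    (norm_algebraMap_ringOfIntegers_le_one K v) (exists_norm_algebraMap_adicCompletion_lt_one K v) _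
    (mem_adicCompletionPrime_iff K v)

/-- **`I_{𝔓₀} = res (I_{K_v})`** (for any non-archimedean local field structure on the topological
field `K_v`, as in `GaloisRep.isUnramifiedAt_iff_toLocal`): the inertia group of `𝔓₀` is the image
under `res` of the local inertia group `absInertia K_v`.  Neukirch, *Algebraic Number Theory*,
Ch. II §9, Prop. (9.6) (`I_w(L|K) ≅ I(L_w|K_v)`). [cite: NeukirchANT1999, Ch. II §9 Prop. (9.6)] -/
theorem inertia_adicCompletionPrime_eq_map_absInertia [ValuativeRel (v.adicCompletion K)]
    [IsNonarchimedeanLocalField (v.adicCompletion K)] :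
    (adicCompletionPrime K v).inertia (absoluteGaloisGroup K) =
      (absInertia (v.adicCompletion K)).map (absGaloisRestrict K (v.adicCompletion K)).toMonoidHom :=
  inertia_eq_map_absInertia_absGaloisRestrict (adicCompletion_valuation_le_one_iff K v)
    (IsDedekindDomain.HeightOneSpectrum.denseRange_algebraMap (K := K) (v := v))
    (norm_algebraMap_ringOfIntegers_le_one K v) (exists_norm_algebraMap_adicCompletion_lt_one K v) _
    (mem_adicCompletionPrime_iff K v) (adicCompletionPrime_isMaximal K v)

/-- **`f(D_{𝔓₀}) = (f ∘ res)(Γ_{K_v})`** for any homomorphism `f` out of `Γ_K` (e.g. a Galois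
representation): the image of the decomposition group is the image of the local group.
[cite: NeukirchANT1999, Ch. II §9 Prop. (9.6)] -/
theorem map_decompositionSubgroup_adicCompletionPrime {H : Type*} [Group H]
    (f : absoluteGaloisGroup K →* H) :
    ((adicCompletionPrime K v).decompositionSubgroup (absoluteGaloisGroup K)).map f =
      (f.comp (absGaloisRestrict K (v.adicCompletion K)).toMonoidHom).range := by
  rw [decompositionSubgroup_adicCompletionPrime_eq_range, MonoidHom.range_comp]

/-- **`f(I_{𝔓₀}) = (f ∘ res)(I_{K_v})`** for any homomorphism `f` out of `Γ_K`.
[cite: NeukirchANT1999, Ch. II §9 Prop. (9.6)] -/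
theorem map_inertia_adicCompletionPrime [ValuativeRel (v.adicCompletion K)]
    [IsNonarchimedeanLocalField (v.adicCompletion K)] {H : Type*} [Group H]
    (f : absoluteGaloisGroup K →* H) :
    ((adicCompletionPrime K v).inertia (absoluteGaloisGroup K)).map f =
      (absInertia (v.adicCompletion K)).map
        (f.comp (absGaloisRestrict K (v.adicCompletion K)).toMonoidHom) := by
  rw [inertia_adicCompletionPrime_eq_map_absInertia, Subgroup.map_map]

/-- **Frobenius at `𝔓₀` ↔ Frobenius of `K_v`** (for any compatible local field structure on
`K_v` whose residue field has `q_v = #(𝓞 K ⧸ v)` elements, hypothesis `hq` — discharged for the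
valued structure of `K_v` by `residueFieldCard_adicCompletion_eq` of
`Automorphic/AdicCompletionResidueCard`): `res σ` is an arithmetic Frobenius at `𝔓₀` iff `σ` is an
arithmetic Frobenius of `K_v`.  Neukirch, *Algebraic Number Theory*, Ch. II §9, Prop. (9.6) with
Ch. I §9. [cite: NeukirchANT1999, Ch. II §9 Prop. (9.6)] -/
theorem isArithFrobAt_absGaloisRestrict_adicCompletionPrime_iff [ValuativeRel (v.adicCompletion K)]
    [IsNonarchimedeanLocalField (v.adicCompletion K)]
    (hq : residueFieldCard (v.adicCompletion K) = Nat.card (𝓞 K ⧸ v.asIdeal))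
    (σ : absoluteGaloisGroup (v.adicCompletion K)) :
    IsArithFrobAt (𝓞 K) (absGaloisRestrict K (v.adicCompletion K) σ) (adicCompletionPrime K v) ↔
      IsAbsArithFrob σ := by
  have hq' : residueFieldCard (v.adicCompletion K) =
      Nat.card (𝓞 K ⧸ (adicCompletionPrime K v).under (𝓞 K)) := by
    rw [under_adicCompletionPrime]; exact hq
  exact ⟨isAbsArithFrob_of_isArithFrobAt_absGaloisRestrict (adicCompletion_valuation_le_one_iff K v)
      (IsDedekindDomain.HeightOneSpectrum.denseRange_algebraMap (K := K) (v := v)) _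
      (mem_adicCompletionPrime_iff K v) (adicCompletionPrime_isMaximal K v) hq',
    isArithFrobAt_absGaloisRestrict_of_isAbsArithFrob (adicCompletion_valuation_le_one_iff K v)
      (norm_algebraMap_ringOfIntegers_le_one K v) _ (mem_adicCompletionPrime_iff K v) hq'⟩

end AdicCompletion

end Literature.NumberTheory.GaloisRepresentations

end
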